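import Mathlib
import Literature.Computability.AlgebraicComplexity.DeterminantalComplexity
import Literature.Computability.AlgebraicComplexity.DeterminantalComplexityProofs
import Literature.Computability.AlgebraicComplexity.DeterminantalConormalBound
import Literature.Computability.AlgebraicComplexity.LandsbergRessayreNormalForm
import Literature.Computability.AlgebraicComplexity.StandardFamilies
import Literature.Computability.AlgebraicComplexity.PermanentVsDeterminant

/-!
# Sketch — crux-ideate stmt-ValiantsHypothesis-0318 (DetqpSuperquadratic), ideator 3, round 1

First-lemma signatures for the two idea cards `Ideas/sectional-class-ladder.md` and
`Ideas/regular-power-width-transfer.md`. Nothing here is a route item; statements only need to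
ELABORATE (crux-ideate rule), the small projection lemma is proved for calibration.
-/

noncomputable section

open MvPolynomial Matrix

namespace Summit.ValiantsHypothesis.ValiantsHypothesis.Cruxes.DetqpSuperquadratic.Sketch

open Literature.Computability.AlgebraicComplexity

/-! ## Card A: sectional-class ladder -/

/-- Determinantal representations survive substitution of AFFINE LINEAR forms (not only
variables/constants): the restriction of `per_n` to a linear subspace keeps `HasDetRepr _ m`.
(Proof copied from `HasDetRepr.of_isProjection_holds`.) -/
theorem hasDetRepr_aeval_of_totalDegree_le_one {σ τ : Type*} {f : MvPolynomial σ ℂ} {m : ℕ}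
    (h : HasDetRepr f m) (a : σ → MvPolynomial τ ℂ) (ha : ∀ i, (a i).totalDegree ≤ 1) :
    HasDetRepr (aeval a f) m := by
  obtain ⟨A, hA, rfl⟩ := h
  refine ⟨(aeval a).mapMatrix A, fun i j => ?_, (AlgHom.map_det _ _).symm⟩
  rw [AlgHom.mapMatrix_apply, Matrix.map_apply]
  exact (HasDetRepr.totalDegree_aeval_le_of_le_one a ha _).trans (hA i j)

/-- RUNG `k` OF THE LADDER (det side, from the in-tree Sheshadri fact): for every linear
restriction `L` of `per_n` to `k+2` variables, the generic polar count (= class of the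
`(k+1)`-plane section `V(per_n) ∩ ℙ^{k+1}`) is at most `B(m, k+2)` whenever `per_n` has an affine
determinantal representation of size `m`. -/
theorem ladder_rung (hS : Sheshadri2026_polarCount_le) {n k m : ℕ} (hk : 1 ≤ k)
    (L : Fin n × Fin n → MvPolynomial (Fin (k + 2)) ℂ) (hL : ∀ ij, (L ij).totalDegree ≤ 1)
    (hhom : (aeval L (perPoly (Fin n) ℂ)).IsHomogeneous n)
    (hm : HasDetRepr (perPoly (Fin n) ℂ) m) :
    ∃ Φ : MvPolynomial (Fin 3 × Fin (k + 2)) ℂ, Φ ≠ 0 ∧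
      ∀ u : Fin 3 × Fin (k + 2) → ℂ, eval u Φ ≠ 0 →
        (polarSet (aeval L (perPoly (Fin n) ℂ)) (fun i => u (0, i)) (fun i => u (1, i))
            (fun i => u (2, i))).ncard ≤ conormalBezout m (k + 2) := by
  have h3 : 3 ≤ Fintype.card (Fin (k + 2)) := by simp; omega
  simpa using hS h3 (aeval L (perPoly (Fin n) ℂ)) n m hhom
    (hasDetRepr_aeval_of_totalDegree_le_one hm L hL)

/-- PER SIDE (the conjecture the card bets on, graded in `k`): **sectional class conjecture**
`SC(ε)`: for all large `n` and every `k` with `2n ≤ k ≤ n^{1+ε}` there is a `(k+2)`-variable linear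
restriction of `per_n` whose polar count (class of the `(k+1)`-plane section of the permanental
hypersurface) is at least `(ε n)^k` for GENERIC pencil/chart data — phrased as: off every
hypersurface `Φ = 0` of data there is a datum realising the bound (the count is constant on a
dense open set, so this is the generic value). For `k ≤ 2n - 3` the section is smooth and the
count is `n (n-1)^k` exactly (classical class formula); the conjecture says the shallow singular
strata of `V(per_n)` (codimension `≤ k+1`) cost at most a constant factor in the base. -/
def SectionalClassConjecture (ε : ℝ) : Prop :=
  ∃ n₀ : ℕ, ∀ n ≥ n₀, ∀ k : ℕ, 2 * n ≤ k → (k : ℝ) ≤ (n : ℝ) ^ (1 + ε) →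
    ∃ L : Fin n × Fin n → MvPolynomial (Fin (k + 2)) ℂ, (∀ ij, (L ij).IsHomogeneous 1) ∧
      ∀ Φ : MvPolynomial (Fin 3 × Fin (k + 2)) ℂ, Φ ≠ 0 →
        ∃ u : Fin 3 × Fin (k + 2) → ℂ, eval u Φ ≠ 0 ∧
          (ε * n) ^ k ≤ ((polarSet (aeval L (perPoly (Fin n) ℂ)) (fun i => u (0, i))
              (fun i => u (1, i)) (fun i => u (2, i))).ncard : ℝ)

/-- The arithmetic target the ladder then has to close (crux-plan's job, recorded for shape):
`(ε n)^k ≤ B(dc(per_n), k+2)` with `k = ⌊n^{1+ε}⌋` forces `dc(per_n) ≥ c_ε · k · n ≥ n^{2+ε'}`,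
because `B(m, N') ≤ 4^{N'} (e m / N')^{N'-1}`-type bounds make `B(m, k+2)^{1/k} = O(m / k)`. -/
def LadderClosesCrux : Prop :=
  ∀ ε : ℝ, 0 < ε → ε < 1 → SectionalClassConjecture ε → Sheshadri2026_polarCount_le →
    ∃ ε' : ℝ, 0 < ε' ∧ ∃ n₀ : ℕ, ∀ n ≥ n₀,
      (n : ℝ) ^ (2 + ε') ≤ (determinantalComplexity (perPoly (Fin n) ℂ) : ℝ)

/-! ## Card B: regular power-width transfer -/

/-- **Power normal form** (first lemma of card B): every affine determinantal representation of
`per_n` (`n ≥ 3`) of size `m+1` yields linear `b, c : ℂ^{n²} → ℂ^m` and a linear `m × m` matrix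
`Y` with `per_n = b · Y^{n-2} · c` and `b · Y^i · c = 0` for `i < n-2` (and `per_n ∣ b · Y^i · c`
for all `i`). Inputs: von zur Gathen regularity (`vonzurGathen1987_perm_detRepr_rank`, rank of
the constant part is exactly `m`), `Matrix.exists_rank_normal_form`-type gauge to
`Λ = diag(0, I_m)`, Schur complement `det [[0, bᵀ],[c, I+Y]] = - bᵀ adj(I+Y) c`, Faddeev–LeVerrier
homogeneity bookkeeping. Consequence: homogeneous-ABP width `w(per_n) ≤ dc(per_n) - 1` and
`hmpc(per_n) ≤ 1 + (n-1)(dc(per_n)-1)` (vs. the cubic loss of IL17 Thm 4.1). -/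
def PowerNormalForm : Prop :=
  vonzurGathen1987_perm_detRepr_rank →
    ∀ n : ℕ, 3 ≤ n → ∀ (m : ℕ) (A : Matrix (Fin (m + 1)) (Fin (m + 1)) (MvPolynomial (Fin n × Fin n) ℂ)),
      IsAffineDetRepr (perPoly (Fin n) ℂ) A →
        ∃ (b c : Fin m → MvPolynomial (Fin n × Fin n) ℂ)
          (Y : Matrix (Fin m) (Fin m) (MvPolynomial (Fin n × Fin n) ℂ)),
          (∀ i, (b i).IsHomogeneous 1) ∧ (∀ i, (c i).IsHomogeneous 1) ∧
            (∀ i j, (Y i j).IsHomogeneous 1) ∧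
            perPoly (Fin n) ℂ = b ⬝ᵥ (Y ^ (n - 2)) *ᵥ c ∧
            (∀ i : ℕ, i < n - 2 → b ⬝ᵥ (Y ^ i) *ᵥ c = 0) ∧
            (∀ i : ℕ, perPoly (Fin n) ℂ ∣ b ⬝ᵥ (Y ^ i) *ᵥ c)

/-- `powerWidth f d`: the least `w` such that `f = b · Y^{d-2} · c` with `b, c, Y` made of
homogeneous linear forms (`w × w` matrix `Y` REPEATED — the single-matrix homogeneous ABP). A
sub-model of homogeneous ABPs of width `w`; `sInf ∅ = 0` junk if no such form exists. -/
def HasPowerRepr {σ : Type*} (f : MvPolynomial σ ℂ) (d w : ℕ) : Prop :=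
  ∃ (b c : Fin w → MvPolynomial σ ℂ) (Y : Matrix (Fin w) (Fin w) (MvPolynomial σ ℂ)),
    (∀ i, (b i).IsHomogeneous 1) ∧ (∀ i, (c i).IsHomogeneous 1) ∧
      (∀ i j, (Y i j).IsHomogeneous 1) ∧ f = b ⬝ᵥ (Y ^ (d - 2)) *ᵥ c

noncomputable def powerWidth {σ : Type*} (f : MvPolynomial σ ℂ) (d : ℕ) : ℕ :=
  sInf {w : ℕ | HasPowerRepr f d w}

/-- TRANSFER C⁺ of card B: super-quadratic POWER WIDTH of the permanent. By `PowerNormalForm`,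
`powerWidth per_n n + 1 ≤ dc(per_n)`, so `PowerWidthSuperquadratic → DetqpSuperquadratic`
(lossless in the exponent); conversely `dc ≤ 1 + (n-1)·powerWidth` only. -/
def PowerWidthSuperquadratic : Prop :=
  ∃ ε : ℝ, 0 < ε ∧ ∃ n₀ : ℕ, ∀ n ≥ n₀,
    (n : ℝ) ^ (2 + ε) ≤ (powerWidth (perPoly (Fin n) ℂ) n : ℝ)

/-- The transfer statement itself (to be proved from `PowerNormalForm` + attainment of `dc`). -/
def PowerWidthTransfer : Prop :=
  PowerNormalForm → PowerWidthSuperquadratic →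
    ∃ ε : ℝ, 0 < ε ∧ ∃ n₀ : ℕ, ∀ n ≥ n₀,
      (n : ℝ) ^ (2 + ε) ≤ (determinantalComplexity (perPoly (Fin n) ℂ) : ℝ)

end Summit.ValiantsHypothesis.ValiantsHypothesis.Cruxes.DetqpSuperquadratic.Sketch
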